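import Summits.NavierStokesRegularity.NavierStokesRegularity.Theorems.TypeIliouvilleNoTypeII.Negative.NSISuperSimilarSeed
import Summits.NavierStokesRegularity.NavierStokesRegularity.Theorems.TypeIliouvilleNoTypeII.Negative.NSISuperGainBlock
import HarnessLib

/-!
# The super-similar switching cascade of a super-gain NSI block is NOT of Type I

Negative-lane support for `Summit.NavierStokesRegularity.NavierStokesRegularity.Theses.TypeILiouville.TypeIliouvilleNoTypeII`
(item `stmt-NavierStokesRegularity-0056`, "every first blow-up of a Leray–Hopf solution from
rapidly decaying data is of Type I"): brick **B3 (formula level)** of the discharge of the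
model-class barrier `NSITypeIIBlowup` ("weak solutions of the Navier–Stokes INEQUALITY blow up at
a Type-II rate"), complementing `NSISuperSimilarSeed` (two-parameter covariance of the pointwise
NSI, `nsi_superPiece`) and `NSISuperGainBlock` (brick B1: a classical NSI block with gain
`g > τ⁻¹`, `exists_superGain_nsiBlock`).

* `pieceG T σ τ a z u j` / `glueG T σ τ a z u` — the **generalised switched field**: amplitude
  `aʲ`, parabolic clock `σ` (switching times `t_j = switchTime T σ j = T Σ_{k<j} σ^{2k}`, blow-up
  time `T₀ = blowupTime T σ = T/(1-σ²)`), spatial similarity ratio `τ` about `x₀ = z/(1-τ)`: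
  `u^{(j)}(t,x) = aʲ u(σ^{-2j}(t - t_j), x₀ + τ^{-j}(x - x₀))`. Scheffer–Ożański's field is the case
  `σ = τ`, `a = τ⁻¹` (`pieceG_eq_piece`, `glueG_eq_glue`, both `rfl`).
* `not_isTypeIBlowup_glueG` — **if `a·σ > 1` and `u(0,·) ≢ 0` the glued field violates every
  Type-I bound `‖𝔲(t,x)‖ ≤ C/√(T₀ - t)` arbitrarily close to `T₀`**: at `t = t_j` on the point
  `x₀ + τʲ(y - x₀)` its size is `aʲ‖u(0,y)‖` while `√(T₀ - t_j) = σʲ√T₀`, and `(aσ)ʲ → ∞`.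
  (Scheffer's case has `aσ = 1`: Type I exactly, `not_isTypeIIBlowup_glue`.)
* `nsi_pieceG` — under the NSI covariance constraint `a σ² = τ` and `aτ ≥ 1` every piece satisfies
  the pointwise Navier–Stokes inequality at every viscosity `ν ∈ [0, ν₀]` during its life span
  (from `nsi_superPiece`); `norm_pieceG_succ_le` — the DROP condition at the switching times
  (`‖u^{(j+1)}(t_{j+1},x)‖ ≤ ‖u^{(j)}(t_{j+1},x)‖`, the `hdrop` hypothesis of the tree's generic
  gluing theorem `isWeakNSISolution_of_piecewise`) is exactly the super-gain inequality
  `a‖u(0,y)‖ ≤ ‖u(T, τy + z)‖` of brick B1.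
* `exists_superCascade_not_isTypeIBlowup` — **unconditionally, there is a classical NSI block and
  a gain `g > τ⁻¹` whose super-similar cascade (`a = g`, `σ = √(τ/g)`, so `aσ² = τ`,
  `aσ = √(gτ) > 1`) satisfies the piecewise NSI, the drop condition, and is NOT of Type I at
  `T₀`.** What remains for `NSITypeIIBlowup_holds` (brick B2, not here) is the weak-solution
  packaging of `glueG` (energy/integrability sums, ratio `g²τ³ < 1`, and the local energy
  inequality across the switching times), i.e. the parametrised copy of `SchefferSwitched*`.

[cite: Ozanski2017NSISingular, §2 (2.2)–(2.5), §2.1 (p. 6)] for the switching construction and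
its Type-I rate; the super-similar variant (`a > τ⁻¹`) is [folklore] bookkeeping on top of it.
-/

noncomputable section

open Set Function Filter Topology Metric MeasureTheory
open scoped InnerProductSpace RealInnerProductSpace ContDiff Laplacian

set_option linter.dupNamespace false

namespace Summit.NavierStokesRegularity.NavierStokesRegularity.Theorems.TypeIliouvilleNoTypeIINegative

open Literature.Analysis.FluidPDE Literature.Barriers.NavierStokesRegularity
open Literature.Barriers.NavierStokesRegularity.Scheffer

section Field

variable {E : Type*} [NormedAddCommGroup E] [InnerProductSpace ℝ E]

/-- **The `j`-th generalised piece** `u^{(j)}(t, x) = aʲ u(σ^{-2j}(t - t_j), x₀ + τ^{-j}(x - x₀))`,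
`t_j = switchTime T σ j`, `x₀ = z/(1-τ)`, as an affine pull-back (`stPull`, time first).
[cite: Ozanski2017NSISingular, §2 (2.4)] -/
def pieceG (T σ τ a : ℝ) (z : E) (u : ℝ → E → E) (j : ℕ) : ℝ → E → E :=
  a ^ j • stPull ((σ⁻¹) ^ (2 * j)) ((τ⁻¹) ^ j) (-((σ⁻¹) ^ (2 * j) * switchTime T σ j))
    ((1 - (τ⁻¹) ^ j) • (1 - τ)⁻¹ • z) u

/-- Pointwise formula for the generalised piece. [cite: Ozanski2017NSISingular, §2 (2.4)] -/
theorem pieceG_apply (T σ τ a : ℝ) (z : E) (u : ℝ → E → E) (j : ℕ) (t : ℝ) (x : E) :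
    pieceG T σ τ a z u j t x = a ^ j •
      u ((σ⁻¹) ^ (2 * j) * (t - switchTime T σ j))
        ((1 - τ)⁻¹ • z + (τ⁻¹) ^ j • (x - (1 - τ)⁻¹ • z)) := by
  rw [pieceG, smul_stPull_apply]
  congr 2
  · ring
  · rw [smul_sub, sub_smul, one_smul, smul_comm ((τ⁻¹) ^ j) ((1 - τ)⁻¹) z]
    abel

/-- Scheffer–Ożański's piece is the case `σ = τ`, `a = τ⁻¹`. [cite: Ozanski2017NSISingular, §2 (2.4)] -/
theorem pieceG_eq_piece (T τ : ℝ) (z : E) (u : ℝ → E → E) :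
    pieceG T τ τ τ⁻¹ z u = piece T τ z u := rfl

/-- At the START of its life span: `u^{(j)}(t_j, x) = aʲ u(0, x₀ + τ^{-j}(x - x₀))`. [folklore] -/
theorem pieceG_apply_switchTime (T σ τ a : ℝ) (z : E) (u : ℝ → E → E) (j : ℕ) (x : E) :
    pieceG T σ τ a z u j (switchTime T σ j) x =
      a ^ j • u 0 ((1 - τ)⁻¹ • z + (τ⁻¹) ^ j • (x - (1 - τ)⁻¹ • z)) := by
  rw [pieceG_apply, sub_self, mul_zero]

/-- At the END of its life span: `u^{(j)}(t_{j+1}, x) = aʲ u(T, x₀ + τ^{-j}(x - x₀))` (`σ ≠ 0`).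
[folklore] -/
theorem pieceG_apply_switchTime_succ (T : ℝ) {σ : ℝ} (hσ : σ ≠ 0) (τ a : ℝ) (z : E)
    (u : ℝ → E → E) (j : ℕ) (x : E) :
    pieceG T σ τ a z u j (switchTime T σ (j + 1)) x =
      a ^ j • u T ((1 - τ)⁻¹ • z + (τ⁻¹) ^ j • (x - (1 - τ)⁻¹ • z)) := by
  have hinv : (σ⁻¹) ^ (2 * j) * σ ^ (2 * j) = 1 := by
    rw [inv_pow, inv_mul_cancel₀ (pow_ne_zero _ hσ)]
  rw [pieceG_apply, switchTime_succ, add_sub_cancel_left, mul_comm T, ← mul_assoc, hinv, one_mul]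

/-- The `j`-th piece at its start, evaluated on the `τʲ`-rescaled point `x₀ + τʲ(y - x₀)`
(`= Γʲ y`), is `aʲ u(0, y)`. [folklore] -/
theorem pieceG_apply_switchTime_center {τ : ℝ} (hτ : τ ≠ 0) (T σ a : ℝ) (z : E)
    (u : ℝ → E → E) (j : ℕ) (y : E) :
    pieceG T σ τ a z u j (switchTime T σ j) ((1 - τ)⁻¹ • z + τ ^ j • (y - (1 - τ)⁻¹ • z)) =
      a ^ j • u 0 y := by
  rw [pieceG_apply_switchTime, add_sub_cancel_left, smul_smul, inv_pow,
    inv_mul_cancel₀ (pow_ne_zero _ hτ), one_smul, add_sub_cancel]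

/-- **The drop condition at the switching times is the super-gain inequality**: if
`a‖u(0,y)‖ ≤ ‖u(T, τy + z)‖` for all `y` (brick B1 with `g = a`), then
`‖u^{(j+1)}(t_{j+1}, x)‖ ≤ ‖u^{(j)}(t_{j+1}, x)‖` for all `j, x` (the `hdrop` hypothesis of
`isWeakNSISolution_of_piecewise`). [cite: Ozanski2017NSISingular, §2 (2.2), (2.5)] -/
theorem norm_pieceG_succ_le {T σ τ a : ℝ} (hσ : σ ≠ 0) (hτ₀ : τ ≠ 0) (hτ₁ : τ ≠ 1) (ha : 0 ≤ a)
    (z : E) {u : ℝ → E → E} (hgain : ∀ y : E, a * ‖u 0 y‖ ≤ ‖u T (τ • y + z)‖) (j : ℕ) (x : E) :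
    ‖pieceG T σ τ a z u (j + 1) (switchTime T σ (j + 1)) x‖ ≤
      ‖pieceG T σ τ a z u j (switchTime T σ (j + 1)) x‖ := by
  rw [pieceG_apply_switchTime, pieceG_apply_switchTime_succ T hσ]
  have hcoef : τ * (τ⁻¹) ^ (j + 1) = (τ⁻¹) ^ j := by
    rw [pow_succ, ← mul_assoc, mul_comm τ, mul_assoc, mul_inv_cancel₀ hτ₀, mul_one]
  -- `Γ y = x₀ + τ^{-j}(x - x₀)` for `y = x₀ + τ^{-(j+1)}(x - x₀)`
  have hyx : τ • ((1 - τ)⁻¹ • z + (τ⁻¹) ^ (j + 1) • (x - (1 - τ)⁻¹ • z)) + z =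
      (1 - τ)⁻¹ • z + (τ⁻¹) ^ j • (x - (1 - τ)⁻¹ • z) := by
    rw [smul_add, smul_smul τ ((τ⁻¹) ^ (j + 1)), hcoef, add_right_comm, smul_center_add hτ₁ z]
  rw [← hyx, norm_smul, norm_smul, Real.norm_of_nonneg (pow_nonneg ha _),
    Real.norm_of_nonneg (pow_nonneg ha _), pow_succ, mul_assoc]
  exact mul_le_mul_of_nonneg_left (hgain _) (pow_nonneg ha _)

open Classical in
/-- **The generalised switched (glued) field** `𝔲`: `𝔲(t) = u^{(j)}(t)` on `[t_j, t_{j+1})`,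
`𝔲(t) = 0` for `t ≥ T₀` and for `t < 0`. [cite: Ozanski2017NSISingular, §2 (2.4)] -/
def glueG (T σ τ a : ℝ) (z : E) (u : ℝ → E → E) : ℝ → E → E := fun t x =>
  if h : ∃ j : ℕ, t ∈ Ico (switchTime T σ j) (switchTime T σ (j + 1)) then
    pieceG T σ τ a z u h.choose t x
  else 0

/-- Scheffer–Ożański's glued field is the case `σ = τ`, `a = τ⁻¹`. [cite: Ozanski2017NSISingular, §2 (2.4)] -/
theorem glueG_eq_glue (T τ : ℝ) (z : E) (u : ℝ → E → E) :
    glueG T τ τ τ⁻¹ z u = glue T τ z u := rfl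

open Classical in
/-- On the `j`-th piece the glued field is `u^{(j)}` (`T > 0`, `σ > 0`). [folklore] -/
theorem glueG_eq_pieceG {T σ : ℝ} (hT : 0 < T) (hσ : 0 < σ) (τ a : ℝ) (z : E) (u : ℝ → E → E)
    {t : ℝ} {j : ℕ} (hj : t ∈ Ico (switchTime T σ j) (switchTime T σ (j + 1))) :
    glueG T σ τ a z u t = pieceG T σ τ a z u j t := by
  funext x
  have h : ∃ j : ℕ, t ∈ Ico (switchTime T σ j) (switchTime T σ (j + 1)) := ⟨j, hj⟩
  rw [glueG, dif_pos h, eq_of_mem_Ico_switchTime hT hσ h.choose_spec hj]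

open Classical in
/-- Outside `⋃ⱼ [t_j, t_{j+1})` the glued field vanishes. [folklore] -/
theorem glueG_eq_zero_of_not_exists {T σ : ℝ} (τ a : ℝ) (z : E) (u : ℝ → E → E) {t : ℝ}
    (h : ¬ ∃ j : ℕ, t ∈ Ico (switchTime T σ j) (switchTime T σ (j + 1))) :
    glueG T σ τ a z u t = 0 := by
  funext x
  rw [glueG, dif_neg h]
  rfl

/-- For `t ≥ T₀` the glued field vanishes (`T > 0`, `0 < σ < 1`). [folklore] -/
theorem glueG_eq_zero_of_le {T σ : ℝ} (hT : 0 < T) (hσ₀ : 0 < σ) (hσ₁ : σ < 1) (τ a : ℝ) (z : E)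
    (u : ℝ → E → E) {t : ℝ} (ht : blowupTime T σ ≤ t) : glueG T σ τ a z u t = 0 := by
  refine glueG_eq_zero_of_not_exists τ a z u fun ⟨j, hj⟩ => ?_
  exact (not_lt.2 ht) (hj.2.trans (switchTime_lt_blowupTime hT hσ₀ hσ₁ (j + 1)))

/-- For `t < 0` the glued field vanishes (`T > 0`, `σ > 0`). [folklore] -/
theorem glueG_eq_zero_of_neg {T σ : ℝ} (hT : 0 < T) (hσ : 0 < σ) (τ a : ℝ) (z : E)
    (u : ℝ → E → E) {t : ℝ} (ht : t < 0) : glueG T σ τ a z u t = 0 := by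
  refine glueG_eq_zero_of_not_exists τ a z u fun ⟨j, hj⟩ => ?_
  exact (not_le.2 ht) ((switchTime_nonneg hT hσ j).trans hj.1)

/-- `t_j ∈ [t_j, t_{j+1})`. [folklore] -/
theorem switchTime_mem_Ico {T σ : ℝ} (hT : 0 < T) (hσ : 0 < σ) (j : ℕ) :
    switchTime T σ j ∈ Ico (switchTime T σ j) (switchTime T σ (j + 1)) :=
  ⟨le_rfl, strictMono_switchTime hT hσ (Nat.lt_succ_self j)⟩

/-- **The size of the glued field at the switching time `t_j` on the point `x₀ + τʲ(y - x₀)` is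
`aʲ‖u(0,y)‖`.** [folklore] -/
theorem norm_glueG_switchTime_center {T σ τ a : ℝ} (hT : 0 < T) (hσ : 0 < σ) (hτ : τ ≠ 0)
    (ha : 0 ≤ a) (z : E) (u : ℝ → E → E) (j : ℕ) (y : E) :
    ‖glueG T σ τ a z u (switchTime T σ j) ((1 - τ)⁻¹ • z + τ ^ j • (y - (1 - τ)⁻¹ • z))‖ =
      a ^ j * ‖u 0 y‖ := by
  rw [glueG_eq_pieceG hT hσ τ a z u (switchTime_mem_Ico hT hσ j),
    pieceG_apply_switchTime_center hτ, norm_smul, Real.norm_of_nonneg (pow_nonneg ha _)]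

/-- `√(T₀ - t_j) = σʲ √T₀`: the parabolic clock. [folklore] -/
theorem sqrt_blowupTime_sub_switchTime (T : ℝ) {σ : ℝ} (hσ₀ : 0 ≤ σ) (hσ : σ ^ 2 ≠ 1) (j : ℕ) :
    Real.sqrt (blowupTime T σ - switchTime T σ j) = σ ^ j * Real.sqrt (blowupTime T σ) := by
  rw [blowupTime_sub_switchTime T hσ j, Real.sqrt_mul (pow_nonneg hσ₀ _), pow_mul',
    Real.sqrt_sq (pow_nonneg hσ₀ _)]

/-- **The generalised switched field is NOT of Type I at `T₀` when the amplitude beats the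
parabolic clock (`aσ > 1`) and `u(0,·) ≢ 0`**: for every `C` the Type-I bound
`‖𝔲(t,x)‖ ≤ C/√(T₀ - t)` fails at `t = t_j`, `x = x₀ + τʲ(y - x₀)` for all large `j`, because
there `‖𝔲‖ √(T₀ - t_j) = (aσ)ʲ ‖u(0,y)‖ √T₀ → ∞`. (For Scheffer–Ożański's field `aσ = 1` and the
blow-up IS of Type I, `not_isTypeIIBlowup_glue`.) [cite: Ozanski2017NSISingular, §2.1 (p. 6)] -/
theorem not_isTypeIBlowup_glueG {T σ τ a : ℝ} (hT : 0 < T) (hσ₀ : 0 < σ) (hσ₁ : σ < 1)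
    (hτ : τ ≠ 0) (haσ : 1 < a * σ) (z : E) {u : ℝ → E → E} (hu : ∃ y, u 0 y ≠ 0) :
    ¬ IsTypeIBlowup (glueG T σ τ a z u) (blowupTime T σ) := by
  rintro ⟨C, hC⟩
  obtain ⟨y, hy⟩ := hu
  have ha : 0 < a := by
    by_contra h
    have : a * σ ≤ 0 := mul_nonpos_of_nonpos_of_nonneg (not_lt.1 h) hσ₀.le
    linarith
  have hσ2 : σ ^ 2 < 1 := pow_lt_one₀ hσ₀.le hσ₁ two_ne_zero
  have hT₀ : 0 < blowupTime T σ := div_pos hT (sub_pos.2 hσ2)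
  have hm : 0 < ‖u 0 y‖ := norm_pos_iff.2 hy
  have hsq : 0 < Real.sqrt (blowupTime T σ) := Real.sqrt_pos.2 hT₀
  have htend : Tendsto (switchTime T σ) atTop (𝓝[<] blowupTime T σ) :=
    tendsto_nhdsWithin_iff.2 ⟨tendsto_switchTime hσ₀.le hσ₁,
      Eventually.of_forall fun j => switchTime_lt_blowupTime hT hσ₀ hσ₁ j⟩
  have h1 : ∀ᶠ j : ℕ in atTop, ∀ x, ‖glueG T σ τ a z u (switchTime T σ j) x‖ ≤
      C / Real.sqrt (blowupTime T σ - switchTime T σ j) := htend.eventually hC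
  have h2 : ∀ᶠ j : ℕ in atTop, C < (a * σ) ^ j * (‖u 0 y‖ * Real.sqrt (blowupTime T σ)) :=
    ((tendsto_pow_atTop_atTop_of_one_lt haσ).atTop_mul_const (mul_pos hm hsq)).eventually_gt_atTop C
  obtain ⟨j, hj1, hj2⟩ := (h1.and h2).exists
  have hb := hj1 ((1 - τ)⁻¹ • z + τ ^ j • (y - (1 - τ)⁻¹ • z))
  rw [norm_glueG_switchTime_center hT hσ₀ hτ ha.le, sqrt_blowupTime_sub_switchTime T hσ₀.le hσ2.ne,
    le_div_iff₀ (mul_pos (pow_pos hσ₀ _) hsq)] at hb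
  have : (a * σ) ^ j * (‖u 0 y‖ * Real.sqrt (blowupTime T σ)) =
      a ^ j * ‖u 0 y‖ * (σ ^ j * Real.sqrt (blowupTime T σ)) := by
    rw [mul_pow]; ring
  linarith

/-- Hence, when moreover `T₀` is a singular time, the blow-up of the generalised switched field
is of **Type II** (`IsTypeIIBlowup = IsSingularTime ∧ ¬ IsTypeIBlowup`). [folklore] -/
theorem isTypeIIBlowup_glueG_of_isSingularTime [MeasureSpace E] {T σ τ a : ℝ} (hT : 0 < T)
    (hσ₀ : 0 < σ) (hσ₁ : σ < 1) (hτ : τ ≠ 0) (haσ : 1 < a * σ) (z : E) {u : ℝ → E → E}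
    (hu : ∃ y, u 0 y ≠ 0) (hsing : IsSingularTime (glueG T σ τ a z u) (blowupTime T σ)) :
    IsTypeIIBlowup (glueG T σ τ a z u) (blowupTime T σ) :=
  ⟨hsing, not_isTypeIBlowup_glueG hT hσ₀ hσ₁ hτ haσ z hu⟩

end Field

/-! ### The pieces satisfy the Navier–Stokes inequality (covariance constraint `aσ² = τ`) -/

/-- **Each generalised piece of an NSI block satisfies the pointwise Navier–Stokes inequality
during its life span, at every viscosity `ν ∈ [0, ν₀]`**, provided the NSI covariance constraint
`a σ² = τ` (amplitude × time factor⁻¹ … : `σ^{-2j} = aʲ τ^{-j}`) and `aτ ≥ 1` (the effective block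
viscosity `ν (aτ)^{-j}` stays in `[0, ν₀]`) hold: `nsi_superPiece` with amplitude `aʲ` and space
factor `τ^{-j}`. [cite: Ozanski2017NSISingular, §2 (2.4)] -/
theorem nsi_pieceG
    {T ν₀ τ : ℝ} {z : EuclideanSpace ℝ (Fin 3)} {G : Set (EuclideanSpace ℝ (Fin 3))}
    {u : ℝ → EuclideanSpace ℝ (Fin 3) → EuclideanSpace ℝ (Fin 3)}
    (h : IsNSIBlock T ν₀ τ z G u) {σ a : ℝ} (ha : 0 < a) (hcov : a * σ ^ 2 = τ) (haτ : 1 ≤ a * τ)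
    {ν : ℝ} (hν : ν ∈ Icc 0 ν₀) (j : ℕ) {s : ℝ}
    (hs : (σ⁻¹) ^ (2 * j) * (s - switchTime T σ j) ∈ Icc 0 T) (x : EuclideanSpace ℝ (Fin 3)) :
    timeDeriv (fun r y => ‖pieceG T σ τ a z u j r y‖ ^ 2) s x ≤
      -⟪pieceG T σ τ a z u j s x, gradient (fun y => ‖pieceG T σ τ a z u j s y‖ ^ 2 +
          2 * normalisedPressure (pieceG T σ τ a z u j s) y) x⟫ +
        2 * ν * ⟪pieceG T σ τ a z u j s x, Δ (pieceG T σ τ a z u j s) x⟫ := by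
  have hτ : 0 < τ := h.τ_pos
  -- the covariance constraint at generation `j`: `σ^{-2j} = aʲ · τ^{-j}`
  have hθ : (σ⁻¹) ^ (2 * j) = a ^ j * (τ⁻¹) ^ j := by
    have hσ2 : σ ^ 2 = τ / a := by rw [← hcov]; field_simp
    rw [inv_pow, pow_mul, hσ2, ← mul_pow, ← inv_pow]
    congr 1
    field_simp
  -- `b = τ^{-j} ≤ aʲ` from `aτ ≥ 1`
  have hba : (τ⁻¹) ^ j ≤ a ^ j := by
    rw [inv_pow]
    refine (inv_le_iff_one_le_mul₀ (pow_pos hτ _)).2 ?_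
    rw [← mul_pow]
    exact one_le_pow₀ (by simpa only [mul_comm] using haτ)
  have hs' : -((σ⁻¹) ^ (2 * j) * switchTime T σ j) + a ^ j * (τ⁻¹) ^ j * s ∈ Icc 0 T := by
    rw [← hθ]
    convert hs using 1
    ring
  have key := nsi_superPiece h (pow_pos ha j) (pow_pos (inv_pos.2 hτ) j) hba hν
    (-((σ⁻¹) ^ (2 * j) * switchTime T σ j)) ((1 - (τ⁻¹) ^ j) • (1 - τ)⁻¹ • z) hs' x
  simpa only [pieceG, hθ] using key

/-! ### The super-similar cascade of a super-gain block -/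

/-- **Parameters of the super-similar cascade of a super-gain block**: for `0 < τ < 1` and a gain
`g > τ⁻¹` put `a = g`, `σ = √(τ/g)`; then `0 < σ < 1`, `aσ² = τ` (NSI covariance), `aσ = √(gτ) > 1`
(the amplitude beats the parabolic clock) and `aτ ≥ 1`. [folklore] -/
theorem superCascade_params {τ g : ℝ} (hτ₀ : 0 < τ) (hτ₁ : τ < 1) (hg : τ⁻¹ < g) :
    0 < Real.sqrt (τ / g) ∧ Real.sqrt (τ / g) < 1 ∧ g * Real.sqrt (τ / g) ^ 2 = τ ∧
      1 < g * Real.sqrt (τ / g) ∧ 1 ≤ g * τ := by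
  have hτinv : 0 < τ⁻¹ := inv_pos.2 hτ₀
  have hg0 : 0 < g := hτinv.trans hg
  have hgτ : 1 < g * τ := by
    have := mul_lt_mul_of_pos_right hg hτ₀
    rwa [inv_mul_cancel₀ hτ₀.ne'] at this
  have hq : 0 < τ / g := div_pos hτ₀ hg0
  have hq1 : τ / g < 1 := by
    rw [div_lt_one hg0]
    have h1 : (1 : ℝ) < τ⁻¹ := one_lt_inv_iff₀.2 ⟨hτ₀, hτ₁⟩
    linarith
  have hsq : Real.sqrt (τ / g) ^ 2 = τ / g := Real.sq_sqrt hq.le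
  refine ⟨Real.sqrt_pos.2 hq, (Real.sqrt_lt' one_pos).2 (by rwa [one_pow]), ?_, ?_, hgτ.le⟩
  · rw [hsq, mul_div_cancel₀ _ hg0.ne']
  · have h2 : (g * Real.sqrt (τ / g)) ^ 2 = g * τ := by
      rw [mul_pow, hsq]; field_simp
    nlinarith [Real.sqrt_nonneg (τ / g), sq_nonneg (g * Real.sqrt (τ / g) - 1),
      mul_nonneg hg0.le (Real.sqrt_nonneg (τ / g))]

/-- **Brick B3 (formula level), unconditional: the super-similar cascade of the super-gain NSI
block of `exists_superGain_nsiBlock` satisfies the piecewise pointwise NSI on every life span at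
every viscosity `ν ∈ [0, ν₀]`, the drop condition at every switching time, and is NOT of Type I
at its blow-up time `T₀ = T/(1 - τ/g)`.** (The glued field's weak-NSI packaging — brick B2 — and
hence `IsSingularTime`/`IsTypeIIBlowup` are not asserted here.)
[cite: Ozanski2017NSISingular, §2 and Prop. 4.2] -/
theorem exists_superCascade_not_isTypeIBlowup :
    ∃ (T ν₀ τ g : ℝ) (z : EuclideanSpace ℝ (Fin 3)) (G : Set (EuclideanSpace ℝ (Fin 3)))
      (u : ℝ → EuclideanSpace ℝ (Fin 3) → EuclideanSpace ℝ (Fin 3)),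
      IsNSIBlock T ν₀ τ z G u ∧ τ⁻¹ < g ∧
      (∀ x : EuclideanSpace ℝ (Fin 3), g * ‖u 0 x‖ ≤ ‖u T (τ • x + z)‖) ∧
      (∀ ν ∈ Icc 0 ν₀, ∀ (j : ℕ) (s : ℝ),
        (Real.sqrt (τ / g))⁻¹ ^ (2 * j) * (s - switchTime T (Real.sqrt (τ / g)) j) ∈ Icc 0 T →
        ∀ x : EuclideanSpace ℝ (Fin 3),
          timeDeriv (fun r y => ‖pieceG T (Real.sqrt (τ / g)) τ g z u j r y‖ ^ 2) s x ≤
            -⟪pieceG T (Real.sqrt (τ / g)) τ g z u j s x,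
                gradient (fun y => ‖pieceG T (Real.sqrt (τ / g)) τ g z u j s y‖ ^ 2 +
                  2 * normalisedPressure (pieceG T (Real.sqrt (τ / g)) τ g z u j s) y) x⟫ +
              2 * ν * ⟪pieceG T (Real.sqrt (τ / g)) τ g z u j s x,
                Δ (pieceG T (Real.sqrt (τ / g)) τ g z u j s) x⟫) ∧
      (∀ (j : ℕ) (x : EuclideanSpace ℝ (Fin 3)),
        ‖pieceG T (Real.sqrt (τ / g)) τ g z u (j + 1) (switchTime T (Real.sqrt (τ / g)) (j + 1)) x‖ ≤
          ‖pieceG T (Real.sqrt (τ / g)) τ g z u j (switchTime T (Real.sqrt (τ / g)) (j + 1)) x‖) ∧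
      ¬ IsTypeIBlowup (glueG T (Real.sqrt (τ / g)) τ g z u) (blowupTime T (Real.sqrt (τ / g))) := by
  obtain ⟨T, ν₀, τ, z, G, u, g, hB, hg, hgain⟩ := exists_superGain_nsiBlock
  obtain ⟨hσ₀, hσ₁, hcov, haσ, haτ⟩ := superCascade_params hB.τ_pos hB.τ_lt_one hg
  have hg0 : 0 < g := (inv_pos.2 hB.τ_pos).trans hg
  refine ⟨T, ν₀, τ, g, z, G, u, hB, hg, hgain, fun ν hν j s hs x => ?_, fun j x => ?_, ?_⟩
  · exact nsi_pieceG hB hg0 hcov haτ hν j hs x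
  · exact norm_pieceG_succ_le hσ₀.ne' hB.τ_pos.ne' hB.τ_lt_one.ne hg0.le z hgain j x
  · exact not_isTypeIBlowup_glueG hB.T_pos hσ₀ hσ₁ hB.τ_pos.ne' haσ z hB.nontrivial

end Summit.NavierStokesRegularity.NavierStokesRegularity.Theorems.TypeIliouvilleNoTypeIINegative

end
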